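import Summits.BirchSwinnertonDyer.BirchSwinnertonDyer.Theorems.KimAtThreeD7uRefinedData
import Summits.BirchSwinnertonDyer.BirchSwinnertonDyer.Theorems.KimAtThreeD7uRefinedKey
import HarnessLib

/-!
# D7-u, file C2: the refined module — submodules of refined / null data, the linear action, the
# generator argument, and linear combinations of conjugates (route W2 = `KimAtThreeKolyvagin`,
# crux 19560 (C3) / TamDiv∞; seat `bsd-addord-w2-tamdiv`)

Book-keeping for the refined THEOREM A2 (next file), all WITHOUT introducing definitions:
* `exists_submodule_refined` / `exists_submodule_null`: the refined data (conditions (C1), (C2),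
  (L) of file A) and the null data form `R`-submodules `S ⊇ N` of
  `P = Z¹(U, X) × (G → X)` — given as `∃ S, ∀ q, q ∈ S ↔ …`;
* `exists_act`: the action `g · (z, η) = (g · z, η(g⁻¹ ·))` is `R`-linear on `P` (`∃` a family of
  linear maps with this formula) and multiplicative;
* `fixed_of_forall_gens`: an abstract form of F3b's `conjMap_eq_self_of_forall_sigma` — for a
  multiplicative family of operators `E_g` trivial on a subgroup `U`, a vector fixed by the `E_σ`,
  `σ` in a generating set modulo `U`, is fixed by every `E_g`;
* `oneCocycleClass_combination`, `data_combination`, `red_combination`, `eta_combination`: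
  finite `R`-linear combinations `Σ a_j • (g_j · c)` of conjugates of ONE trivialised cocycle —
  their class is `Σ a_j • g_j · [c]`, they are trivialised by `Σ a_j • s(g_j⁻¹ ·)`, and `ρ̂` of the
  combination is the combination of the `g_j · ρ̂(c, s)` on the nose (this is how the norm relation
  `Σ_j σ^j · c_s = P_ℓ(Fr⁻¹) c_{s∖ℓ}` and its two sides are moved into the refined group).

References: K. Rubin, *Euler Systems* (2000), §4.4 (Def. 4.4.1, Lemma 4.4.2); B. Mazur, K. Rubin,
Mem. AMS 799 (2004), App. A.
-/

set_option autoImplicit false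
-- the Theorems namespace of a single-conjunct summit repeats the summit name by design (D-0017)
set_option linter.dupNamespace false

noncomputable section

open CategoryTheory Function Finset Polynomial
open Literature.NumberTheory.GaloisRepresentations
open Literature.NumberTheory.EllipticCurves (subgroupConj subgroupConj_apply_coe)

universe u v

namespace Summit.BirchSwinnertonDyer.BirchSwinnertonDyer.Theorems.KimAtThreeD7uRefined

variable {R : Type v} [CommRing R] [TopologicalSpace R]
variable {G : Type u} [Group G] [TopologicalSpace G] [IsTopologicalGroup G]
variable (X T : TopRep.{u} R G) (U : Subgroup G) [U.Normal]

/-- Local notation: `𝔠⟦Y, g⟧ z` = the conjugate cocycle `x ↦ g • z(g⁻¹ x g)` on `U`. -/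
local notation3 "𝔠⟦" Y ", " g "⟧" => contOneCocycles.pullback (subgroupConj U g) (conjRepHom Y U g)

/-- Local notation: `𝐫⟦red⟧ c` = the reduced cocycle `red ∘ c` on `U`. -/
local notation3 "𝐫⟦" red "⟧" => contOneCocycles.pullback (ContinuousMonoidHom.id _)
    (X := subgroupRep T U) (Y := subgroupRep X U) ((TopRep.resFunctor (Subgroup.subtype U)).map red)

variable (B : Submodule R X) (D I : Subgroup G)
variable (hIU : ∀ (g τ : G), τ ∈ I → g * τ * g⁻¹ ∈ U)

/-! ### §1 The submodules of refined data and of null data -/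

omit [IsTopologicalGroup G] [U.Normal] in
/-- **The refined data form a submodule**: the pairs `(z, η) ∈ Z¹(U, X) × (G → X)` satisfying
(C1), (C2) and both parts of (L) (file A) are an `R`-submodule (stated as an existence, no
definition is introduced). [folklore] -/
theorem exists_submodule_refined :
    ∃ S : Submodule R (contOneCocycles (subgroupRep X U) × (G → X)), ∀ q, q ∈ S ↔
      ((∀ (u : G) (hu : u ∈ U) (g : G),
          q.2 (u * g) - q.2 g - X.ρ g⁻¹ (q.1.1 ⟨u⁻¹, U.inv_mem hu⟩) ∈ B) ∧
       (∀ (g δ : G), δ ∈ D → q.2 (g * δ) - X.ρ δ⁻¹ (q.2 g) ∈ B) ∧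
       (∀ (g δ : G), δ ∈ D → ∀ (h : g * δ * g⁻¹ ∈ U),
          X.ρ g⁻¹ (q.1.1 ⟨g * δ * g⁻¹, h⟩) - (X.ρ δ (q.2 g) - q.2 g) ∈ B) ∧
       (∀ (g τ : G) (hτ : τ ∈ I),
          X.ρ g⁻¹ (q.1.1 ⟨g * τ * g⁻¹, hIU g τ hτ⟩) - (X.ρ τ (q.2 g) - q.2 g) = 0)) := by
  set C : Set (contOneCocycles (subgroupRep X U) × (G → X)) := {q |
      (∀ (u : G) (hu : u ∈ U) (g : G),
          q.2 (u * g) - q.2 g - X.ρ g⁻¹ (q.1.1 ⟨u⁻¹, U.inv_mem hu⟩) ∈ B) ∧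
       (∀ (g δ : G), δ ∈ D → q.2 (g * δ) - X.ρ δ⁻¹ (q.2 g) ∈ B) ∧
       (∀ (g δ : G), δ ∈ D → ∀ (h : g * δ * g⁻¹ ∈ U),
          X.ρ g⁻¹ (q.1.1 ⟨g * δ * g⁻¹, h⟩) - (X.ρ δ (q.2 g) - q.2 g) ∈ B) ∧
       (∀ (g τ : G) (hτ : τ ∈ I),
          X.ρ g⁻¹ (q.1.1 ⟨g * τ * g⁻¹, hIU g τ hτ⟩) - (X.ρ τ (q.2 g) - q.2 g) = 0)} with hC
  refine ⟨{ carrier := C, add_mem' := ?_, zero_mem' := ?_, smul_mem' := ?_ }, fun q => Iff.rfl⟩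
  · rintro q q' ⟨h1, h2, h3, h4⟩ ⟨h1', h2', h3', h4'⟩
    refine ⟨fun u hu g => ?_, fun g δ hδ => ?_, fun g δ hδ h => ?_, fun g τ hτ => ?_⟩
    · have e : (q + q').2 (u * g) - (q + q').2 g - X.ρ g⁻¹ ((q + q').1.1 ⟨u⁻¹, U.inv_mem hu⟩) =
          (q.2 (u * g) - q.2 g - X.ρ g⁻¹ (q.1.1 ⟨u⁻¹, U.inv_mem hu⟩)) +
          (q'.2 (u * g) - q'.2 g - X.ρ g⁻¹ (q'.1.1 ⟨u⁻¹, U.inv_mem hu⟩)) := by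
        simp only [Prod.snd_add, Prod.fst_add, Pi.add_apply, Submodule.coe_add,
          ContinuousMap.add_apply, map_add]
        abel
      rw [e]; exact B.add_mem (h1 u hu g) (h1' u hu g)
    · have e : (q + q').2 (g * δ) - X.ρ δ⁻¹ ((q + q').2 g) =
          (q.2 (g * δ) - X.ρ δ⁻¹ (q.2 g)) + (q'.2 (g * δ) - X.ρ δ⁻¹ (q'.2 g)) := by
        simp only [Prod.snd_add, Pi.add_apply, map_add]
        abel
      rw [e]; exact B.add_mem (h2 g δ hδ) (h2' g δ hδ)
    · have e : X.ρ g⁻¹ ((q + q').1.1 ⟨g * δ * g⁻¹, h⟩) - (X.ρ δ ((q + q').2 g) - (q + q').2 g) =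
          (X.ρ g⁻¹ (q.1.1 ⟨g * δ * g⁻¹, h⟩) - (X.ρ δ (q.2 g) - q.2 g)) +
          (X.ρ g⁻¹ (q'.1.1 ⟨g * δ * g⁻¹, h⟩) - (X.ρ δ (q'.2 g) - q'.2 g)) := by
        simp only [Prod.snd_add, Prod.fst_add, Pi.add_apply, Submodule.coe_add,
          ContinuousMap.add_apply, map_add]
        abel
      rw [e]; exact B.add_mem (h3 g δ hδ h) (h3' g δ hδ h)
    · have e : X.ρ g⁻¹ ((q + q').1.1 ⟨g * τ * g⁻¹, hIU g τ hτ⟩) -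
            (X.ρ τ ((q + q').2 g) - (q + q').2 g) =
          (X.ρ g⁻¹ (q.1.1 ⟨g * τ * g⁻¹, hIU g τ hτ⟩) - (X.ρ τ (q.2 g) - q.2 g)) +
          (X.ρ g⁻¹ (q'.1.1 ⟨g * τ * g⁻¹, hIU g τ hτ⟩) - (X.ρ τ (q'.2 g) - q'.2 g)) := by
        simp only [Prod.snd_add, Prod.fst_add, Pi.add_apply, Submodule.coe_add,
          ContinuousMap.add_apply, map_add]
        abel
      rw [e, h4 g τ hτ, h4' g τ hτ, add_zero]
  · refine ⟨fun u hu g => ?_, fun g δ hδ => ?_, fun g δ hδ h => ?_, fun g τ hτ => ?_⟩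
    · simp only [Prod.snd_zero, Prod.fst_zero, Pi.zero_apply, Submodule.coe_zero,
        ContinuousMap.zero_apply, map_zero, sub_self, Submodule.zero_mem]
    · simp only [Prod.snd_zero, Pi.zero_apply, map_zero, sub_self, Submodule.zero_mem]
    · simp only [Prod.snd_zero, Prod.fst_zero, Pi.zero_apply, Submodule.coe_zero,
        ContinuousMap.zero_apply, map_zero, sub_self, Submodule.zero_mem]
    · simp only [Prod.snd_zero, Prod.fst_zero, Pi.zero_apply, Submodule.coe_zero,
        ContinuousMap.zero_apply, map_zero, sub_self]
  · rintro a q ⟨h1, h2, h3, h4⟩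
    refine ⟨fun u hu g => ?_, fun g δ hδ => ?_, fun g δ hδ h => ?_, fun g τ hτ => ?_⟩
    · have e : (a • q).2 (u * g) - (a • q).2 g - X.ρ g⁻¹ ((a • q).1.1 ⟨u⁻¹, U.inv_mem hu⟩) =
          a • (q.2 (u * g) - q.2 g - X.ρ g⁻¹ (q.1.1 ⟨u⁻¹, U.inv_mem hu⟩)) := by
        simp only [Prod.smul_snd, Prod.smul_fst, Pi.smul_apply, Submodule.coe_smul,
          ContinuousMap.smul_apply, map_smul, smul_sub]
      rw [e]; exact B.smul_mem a (h1 u hu g)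
    · have e : (a • q).2 (g * δ) - X.ρ δ⁻¹ ((a • q).2 g) = a • (q.2 (g * δ) - X.ρ δ⁻¹ (q.2 g)) := by
        simp only [Prod.smul_snd, Pi.smul_apply, map_smul, smul_sub]
      rw [e]; exact B.smul_mem a (h2 g δ hδ)
    · have e : X.ρ g⁻¹ ((a • q).1.1 ⟨g * δ * g⁻¹, h⟩) - (X.ρ δ ((a • q).2 g) - (a • q).2 g) =
          a • (X.ρ g⁻¹ (q.1.1 ⟨g * δ * g⁻¹, h⟩) - (X.ρ δ (q.2 g) - q.2 g)) := by
        simp only [Prod.smul_snd, Prod.smul_fst, Pi.smul_apply, Submodule.coe_smul,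
          ContinuousMap.smul_apply, map_smul, smul_sub]
      rw [e]; exact B.smul_mem a (h3 g δ hδ h)
    · have e : X.ρ g⁻¹ ((a • q).1.1 ⟨g * τ * g⁻¹, hIU g τ hτ⟩) -
            (X.ρ τ ((a • q).2 g) - (a • q).2 g) =
          a • (X.ρ g⁻¹ (q.1.1 ⟨g * τ * g⁻¹, hIU g τ hτ⟩) - (X.ρ τ (q.2 g) - q.2 g)) := by
        simp only [Prod.smul_snd, Prod.smul_fst, Pi.smul_apply, Submodule.coe_smul,
          ContinuousMap.smul_apply, map_smul, smul_sub]
      rw [e, h4 g τ hτ, smul_zero]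

omit [IsTopologicalGroup G] [U.Normal] in
/-- **The null data form a submodule**: pairs `(dα, η)` with `η_g ≡ g⁻¹ α (mod B)`, stated as an
existence. [folklore] -/
theorem exists_submodule_null :
    ∃ N : Submodule R (contOneCocycles (subgroupRep X U) × (G → X)), ∀ q, q ∈ N ↔
      ∃ α : X, (∀ x : U, q.1.1 x = X.ρ (x : G) α - α) ∧ ∀ g, q.2 g - X.ρ g⁻¹ α ∈ B := by
  set C : Set (contOneCocycles (subgroupRep X U) × (G → X)) := {q |
      ∃ α : X, (∀ x : U, q.1.1 x = X.ρ (x : G) α - α) ∧ ∀ g, q.2 g - X.ρ g⁻¹ α ∈ B} with hC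
  refine ⟨{ carrier := C, add_mem' := ?_, zero_mem' := ?_, smul_mem' := ?_ }, fun q => Iff.rfl⟩
  · rintro q q' ⟨α, hα, hη⟩ ⟨α', hα', hη'⟩
    refine ⟨α + α', fun x => ?_, fun g => ?_⟩
    · rw [Prod.fst_add, Submodule.coe_add, ContinuousMap.add_apply, hα, hα', map_add]; abel
    · have e : (q + q').2 g - X.ρ g⁻¹ (α + α') = (q.2 g - X.ρ g⁻¹ α) + (q'.2 g - X.ρ g⁻¹ α') := by
        rw [Prod.snd_add, Pi.add_apply, map_add]; abel
      rw [e]; exact B.add_mem (hη g) (hη' g)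
  · refine ⟨0, fun x => ?_, fun g => ?_⟩
    · simp only [Prod.fst_zero, Submodule.coe_zero, ContinuousMap.zero_apply, map_zero, sub_self]
    · simp only [Prod.snd_zero, Pi.zero_apply, map_zero, sub_self, Submodule.zero_mem]
  · rintro a q ⟨α, hα, hη⟩
    refine ⟨a • α, fun x => ?_, fun g => ?_⟩
    · rw [Prod.smul_fst, Submodule.coe_smul, ContinuousMap.smul_apply, hα, map_smul, smul_sub]
    · have e : (a • q).2 g - X.ρ g⁻¹ (a • α) = a • (q.2 g - X.ρ g⁻¹ α) := by
        rw [Prod.smul_snd, Pi.smul_apply, map_smul, smul_sub]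
      rw [e]; exact B.smul_mem a (hη g)

/-! ### §2 The linear action on `P` -/

/-- **The action `g · (z, η) = (g · z, η(g⁻¹ ·))` on `P = Z¹(U, X) × (G → X)` is `R`-linear and
multiplicative** (`(g h) · q = g · (h · q)`, `1 · q = q`), stated as the existence of a family of
linear maps with this formula. [folklore] -/
theorem exists_act :
    ∃ act : G → (contOneCocycles (subgroupRep X U) × (G → X)) →ₗ[R]
        (contOneCocycles (subgroupRep X U) × (G → X)),
      (∀ g q, act g q = (𝔠⟦X, g⟧ q.1, fun h => q.2 (g⁻¹ * h))) ∧
      (∀ g g' q, act (g * g') q = act g (act g' q)) ∧ (∀ q, act 1 q = q) := by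
  refine ⟨fun g =>
    { toFun := fun q => (𝔠⟦X, g⟧ q.1, fun h => q.2 (g⁻¹ * h))
      map_add' := fun q q' => ?_
      map_smul' := fun a q => ?_ }, fun g q => rfl, fun g g' q => ?_, fun q => ?_⟩
  · ext1
    · exact conj_add X U g q.1 q'.1
    · rfl
  · ext1
    · exact conj_smul X U g a q.1
    · rfl
  · change ((𝔠⟦X, g * g'⟧ q.1, fun h => q.2 ((g * g')⁻¹ * h)) : _ × (G → X)) =
      (𝔠⟦X, g⟧ (𝔠⟦X, g'⟧ q.1), fun h => q.2 (g'⁻¹ * (g⁻¹ * h)))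
    ext1
    · exact conj_mul X U g g' q.1
    · funext h
      change q.2 ((g * g')⁻¹ * h) = q.2 (g'⁻¹ * (g⁻¹ * h))
      rw [mul_inv_rev, mul_assoc]
  · change ((𝔠⟦X, (1 : G)⟧ q.1, fun h => q.2 ((1 : G)⁻¹ * h)) : _ × (G → X)) = q
    ext1
    · apply Subtype.ext; ext x
      rw [conj_apply, map_one, one_apply_eq_self]
      exact congrArg _ (Subtype.ext (by change (1 : G)⁻¹ * x * 1 = x; group))
    · funext h
      change q.2 ((1 : G)⁻¹ * h) = q.2 h
      rw [inv_one, one_mul]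

/-! ### §3 The generator argument -/

omit [TopologicalSpace R] [TopologicalSpace G] [IsTopologicalGroup G] in
/-- **A vector fixed by the operators of a generating set is fixed by every operator** (abstract
form of F3b's `conjMap_eq_self_of_forall_sigma`): let `E : G → End(Y)` be multiplicative with
`E_1 = 1` and `E_u = 1` for `u` in a subgroup `U₀`; if every `g ∈ P₀` is `w · u` with `w` in the
subgroup generated by `gens` and `u ∈ U₀` (`hgen`), then a vector fixed by all `E_σ`, `σ ∈ gens`, is
fixed by `E_g` for every `g ∈ P₀`. [folklore] -/
theorem fixed_of_forall_gens {Y : Type*} [AddCommGroup Y] [Module R Y] (E : G → Module.End R Y)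
    (hEmul : ∀ g h, E (g * h) = E g * E h) (hE1 : E 1 = 1) (U₀ : Subgroup G)
    (hEU : ∀ u ∈ U₀, E u = 1) (gens : Set G) (P₀ : Set G)
    (hgen : ∀ g ∈ P₀, ∃ w ∈ Subgroup.closure gens, w⁻¹ * g ∈ U₀)
    (y : Y) (hy : ∀ σ ∈ gens, E σ y = y) (g : G) (hg : g ∈ P₀) : E g y = y := by
  obtain ⟨w, hw, hwg⟩ := hgen g hg
  have hfix : ∀ w ∈ Subgroup.closure gens, E w y = y := by
    intro w hw
    induction hw using Subgroup.closure_induction with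
    | mem x hx => exact hy x hx
    | one => rw [hE1]; rfl
    | mul a b _ _ iha ihb => rw [hEmul, Module.End.mul_apply, ihb, iha]
    | inv a _ iha =>
      have h : E a⁻¹ (E a y) = y := by
        rw [← Module.End.mul_apply, ← hEmul, inv_mul_cancel, hE1]; rfl
      rwa [iha] at h
  have e : g = w * (w⁻¹ * g) := by group
  rw [e, hEmul, Module.End.mul_apply, hEU _ hwg, Module.End.one_apply, hfix w hw]

/-! ### §4 Linear combinations of conjugates of one trivialised cocycle -/

variable (red : T ⟶ X)

/-- The class of a linear combination of conjugate cocycles: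
`[Σ_j a_j • (g_j · c)] = Σ_j a_j • g_j · [c]`. [folklore] -/
theorem oneCocycleClass_combination {κ : Type*} (J : Finset κ) (a : κ → R) (gj : κ → G)
    (c : contOneCocycles (subgroupRep T U)) :
    oneCocycleClass (subgroupRep T U) (∑ j ∈ J, a j • 𝔠⟦T, gj j⟧ c) =
      ∑ j ∈ J, a j • conjMap T U (gj j) 1 (oneCocycleClass (subgroupRep T U) c) := by
  rw [← oneCocycleClassₗ_apply, map_sum]
  refine Finset.sum_congr rfl fun j _ => ?_
  rw [map_smul, oneCocycleClassₗ_apply, conjMap_oneCocycleClass]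

/-- **A linear combination of conjugates is trivialised by the combination of the transported
data**: `Σ_j a_j • s(g_j⁻¹ ·)` trivialises `Σ_j a_j • (g_j · c)`. [folklore] -/
theorem data_combination {κ : Type*} (J : Finset κ) (a : κ → R) (gj : κ → G)
    (c : contOneCocycles (subgroupRep T U)) (s : G → T)
    (hs : ∀ (h τ : G) (hτ : τ ∈ I), T.ρ h⁻¹ (c.1 ⟨h * τ * h⁻¹, hIU h τ hτ⟩) = T.ρ τ (s h) - s h)
    (h τ : G) (hτ : τ ∈ I) :
    T.ρ h⁻¹ ((∑ j ∈ J, a j • 𝔠⟦T, gj j⟧ c).1 ⟨h * τ * h⁻¹, hIU h τ hτ⟩) =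
      T.ρ τ ((∑ j ∈ J, a j • fun h' => s ((gj j)⁻¹ * h')) h) -
        (∑ j ∈ J, a j • fun h' => s ((gj j)⁻¹ * h')) h :=
  data_sum T U I hIU J (fun j => a j • 𝔠⟦T, gj j⟧ c) (fun j => a j • fun h' => s ((gj j)⁻¹ * h'))
    (fun j _ => data_smul T U I hIU (𝔠⟦T, gj j⟧ c) (fun h' => s ((gj j)⁻¹ * h')) (a j)
      (data_conj T U I hIU c s hs (gj j))) h τ hτ

/-- First component of `ρ̂` of a combination: `red ∘ (Σ a_j • g_j · c) = Σ a_j • g_j · (red ∘ c)`.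
[folklore] -/
theorem red_combination {κ : Type*} (J : Finset κ) (a : κ → R) (gj : κ → G)
    (c : contOneCocycles (subgroupRep T U)) :
    𝐫⟦red⟧ (∑ j ∈ J, a j • 𝔠⟦T, gj j⟧ c) = ∑ j ∈ J, a j • 𝔠⟦X, gj j⟧ (𝐫⟦red⟧ c) := by
  rw [rhoHat_sum_fst X T U red J]
  refine Finset.sum_congr rfl fun j _ => ?_
  rw [red_smul, red_conj]

omit [TopologicalSpace G] [IsTopologicalGroup G] [U.Normal] in
/-- Second component of `ρ̂` of a combination:
`red ((Σ a_j • s(g_j⁻¹ ·)) h) = Σ a_j • red (s (g_j⁻¹ h))`. [folklore] -/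
theorem eta_combination {κ : Type*} (J : Finset κ) (a : κ → R) (gj : κ → G) (s : G → T) (h : G) :
    red.hom ((∑ j ∈ J, a j • fun h' => s ((gj j)⁻¹ * h')) h) =
      ∑ j ∈ J, a j • red.hom (s ((gj j)⁻¹ * h)) := by
  rw [Finset.sum_apply, map_sum]
  refine Finset.sum_congr rfl fun j _ => ?_
  rw [Pi.smul_apply, map_smul]


/-- **`ρ̂` of a combination, inside `P`**: for the linear action `act` (`exists_act`),
`Σ_j a_j • act(g_j) (ρ̂(c, s)) = ρ̂(Σ_j a_j • g_j · c, Σ_j a_j • s(g_j⁻¹ ·))` as elements of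
`P = Z¹(U, X) × (G → X)`. [folklore] -/
theorem act_combination
    (act : G → (contOneCocycles (subgroupRep X U) × (G → X)) →ₗ[R]
      (contOneCocycles (subgroupRep X U) × (G → X)))
    (hact : ∀ g q, act g q = (𝔠⟦X, g⟧ q.1, fun h => q.2 (g⁻¹ * h)))
    {κ : Type*} (J : Finset κ) (a : κ → R) (gj : κ → G)
    (c : contOneCocycles (subgroupRep T U)) (s : G → T) :
    ∑ j ∈ J, a j • act (gj j) (𝐫⟦red⟧ c, fun h => red.hom (s h)) =
      (𝐫⟦red⟧ (∑ j ∈ J, a j • 𝔠⟦T, gj j⟧ c),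
        fun h => red.hom ((∑ j ∈ J, a j • fun h' => s ((gj j)⁻¹ * h')) h)) := by
  ext1
  · rw [Prod.fst_sum, red_combination X T U red J a gj c]
    refine Finset.sum_congr rfl fun j _ => ?_
    rw [Prod.smul_fst, hact]
  · funext h
    change (∑ j ∈ J, a j • act (gj j) (𝐫⟦red⟧ c, fun h => red.hom (s h))).2 h =
      red.hom ((∑ j ∈ J, a j • fun h' => s ((gj j)⁻¹ * h')) h)
    rw [Prod.snd_sum, Finset.sum_apply, eta_combination X T red J a gj s h]
    refine Finset.sum_congr rfl fun j _ => ?_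
    rw [Prod.smul_snd, hact, Pi.smul_apply]

end Summit.BirchSwinnertonDyer.BirchSwinnertonDyer.Theorems.KimAtThreeD7uRefined

end
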